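import Summits.ValiantsHypothesis.ValiantsHypothesis.Theses.AnyonJets
import Summits.ValiantsHypothesis.ValiantsHypothesis.Theorems.AnyonJetsResummation

/-!
# ValiantsHypothesis / AnyonJets — item `TwoAdicShadow` (stmt-ValiantsHypothesis-16742)

`per_n − Σ_{k<a} (−2)^k J_{n,k} ∈ 2^a · ℤ[x]` for all `n, a`: by `Resummation`
(`AnyonJets.resummation_proof`) `per_n = Σ_{k<N} (−2)^k J_{n,k}` with `N = n(n−1)/2 + 1`, and
`J_{n,k} = 0` for `k ≥ N` (`C(inv σ, k) = 0` as `inv σ ≤ n(n−1)/2`, `AnyonJets.card_inversions_le`), so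
both sums may be taken over `k < max a N`, and the difference `Σ_{a ≤ k < max a N} (−2)^k J_{n,k}` is
`2^a · Σ (−1)^k 2^{k−a} J_{n,k}`. HONEST FRAMING: a support lemma of a dormant route; nothing here
bears on `VP ≠ VNP`.
-/

-- layout Summits/ValiantsHypothesis/ValiantsHypothesis forces the duplicated namespace component
set_option linter.dupNamespace false

namespace Summit.ValiantsHypothesis.ValiantsHypothesis.Theorems.AnyonJets

open Literature.Computability.AlgebraicComplexity Literature.Combinatorics.Enumerative Finset

/-- `J_{n,k} = 0` for `k > n(n-1)/2`. [folklore] -/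
theorem jet_eq_zero_of_lt {n k : ℕ} (hk : n * (n - 1) / 2 < k) :
    (∑ σ : Equiv.Perm (Fin n), MvPolynomial.C (((Equiv.Perm.sign σ : ℤˣ) : ℤ) *
        (((Finset.univ.filter (fun p : Fin n × Fin n => p.1 < p.2 ∧ σ p.2 < σ p.1)).card.choose k : ℕ) : ℤ)) *
        ∏ i : Fin n, MvPolynomial.X (σ i, i) : MvPolynomial (Fin n × Fin n) ℤ) = 0 := by
  refine Finset.sum_eq_zero fun σ _ => ?_
  have hinv : (Finset.univ.filter (fun p : Fin n × Fin n => p.1 < p.2 ∧ σ p.2 < σ p.1)) =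
      Pfaffian.inversions σ := rfl
  rw [hinv, Nat.choose_eq_zero_of_lt ((card_inversions_le σ).trans_lt hk)]
  simp

/-- **Item `TwoAdicShadow` (stmt-ValiantsHypothesis-16742).** [folklore] -/
theorem twoAdicShadow_proof : Theses.AnyonJets.TwoAdicShadow := by
  unfold Theses.AnyonJets.TwoAdicShadow
  intro J n a
  have hR := resummation_proof
  unfold Theses.AnyonJets.Resummation at hR
  have hper := hR n
  dsimp only [J] at hper ⊢
  -- both sums over `range M`, `M = max a N`
  set N := n * (n - 1) / 2 + 1 with hN
  set M := max a N with hM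
  have hJ0 : ∀ k, N ≤ k → ((-2 : ℤ) ^ k) • (∑ σ : Equiv.Perm (Fin n),
      MvPolynomial.C (((Equiv.Perm.sign σ : ℤˣ) : ℤ) *
        (((Finset.univ.filter (fun p : Fin n × Fin n => p.1 < p.2 ∧ σ p.2 < σ p.1)).card.choose k : ℕ) : ℤ)) *
        ∏ i : Fin n, MvPolynomial.X (σ i, i) : MvPolynomial (Fin n × Fin n) ℤ) = 0 := by
    intro k hk
    rw [jet_eq_zero_of_lt (by omega), smul_zero]
  have hperM : perPoly (Fin n) ℤ = ∑ k ∈ range M, ((-2 : ℤ) ^ k) • (∑ σ : Equiv.Perm (Fin n),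
      MvPolynomial.C (((Equiv.Perm.sign σ : ℤˣ) : ℤ) *
        (((Finset.univ.filter (fun p : Fin n × Fin n => p.1 < p.2 ∧ σ p.2 < σ p.1)).card.choose k : ℕ) : ℤ)) *
        ∏ i : Fin n, MvPolynomial.X (σ i, i) : MvPolynomial (Fin n × Fin n) ℤ) := by
    rw [hper, ← Finset.sum_range_add_sum_Ico _ (le_max_right a N : N ≤ M)]
    rw [Finset.sum_eq_zero (s := Ico N M) fun k hk => hJ0 k (mem_Ico.1 hk).1, add_zero]
  refine ⟨∑ k ∈ Ico a M, ((-1 : ℤ) ^ k * 2 ^ (k - a)) • (∑ σ : Equiv.Perm (Fin n),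
      MvPolynomial.C (((Equiv.Perm.sign σ : ℤˣ) : ℤ) *
        (((Finset.univ.filter (fun p : Fin n × Fin n => p.1 < p.2 ∧ σ p.2 < σ p.1)).card.choose k : ℕ) : ℤ)) *
        ∏ i : Fin n, MvPolynomial.X (σ i, i) : MvPolynomial (Fin n × Fin n) ℤ), ?_⟩
  rw [hperM, ← Finset.sum_range_add_sum_Ico _ (le_max_left a N : a ≤ M), add_sub_cancel_left,
    Finset.smul_sum]
  refine Finset.sum_congr rfl fun k hk => ?_
  rw [smul_smul]
  congr 1
  have hak : a ≤ k := (mem_Ico.1 hk).1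
  rw [← mul_assoc, mul_comm ((2 : ℤ) ^ a), mul_assoc, ← pow_add, Nat.add_sub_cancel' hak,
    ← mul_pow]
  norm_num

end Summit.ValiantsHypothesis.ValiantsHypothesis.Theorems.AnyonJets
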